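import Summits.MatrixMultiplication.OmegaCensus.DihedralLawModOneNonCube
import Summits.MatrixMultiplication.OmegaCensus.DihedralLawModOneSmallExponent
import Summits.MatrixMultiplication.OmegaCensus.CubeLawParityParseval
import HarnessLib

/-!
# The `|A| ≡ 1 (mod 3)` law over `A` with `dim A/2A ≥ 3`: `|A| = 64, 136, 256, 280`

ω-census, family (b3).  Framing: lottery ticket; floor = certified bounds/negative ranges.

Assembly of the classification 'law `3|S||T||U| + 8 = 8|A|` ⟹ `A` has an element of order `≥ |A|/2`' for abelian
groups `A` with three homomorphisms to `ZMod 2` jointly onto `𝔽₂³`.  A law-attaining TPP triple of a dihedral-like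
group over `A` (any `c₀`) has either a non-cube shape — then `A` is two cosets of a cyclic group
(`two_cosets_of_mod_one_law_of_not_cube`) — or cube part sizes `(c,c|d,d|e,e)` with `3cde + 1 = |A|`; by the
Parseval parity theorem (`no_law_cube_part_small`) no part lies in `[2, 6]`, and two parts equal to `1` again give two
cosets (`card_le_two_mul_addOrderOf_of_two_two_law`).  So whenever every factorisation `cde = (|A| − 1)/3` has two
parts `1` or a part in `[2, 6]` — e.g. `(|A| − 1)/3 ∈ {21, 45, 85, 93}`, i.e. `|A| ∈ {64, 136, 256, 280}` — EVERY
law triple forces an element of order `≥ |A|/2`: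

* `card_le_two_mul_addOrderOf_of_law_rank_three` (general, with the factorisation property as a hypothesis);
* `cube_factor_small_64/136/256/280` (the arithmetic);
* `no_law_card_64/136/256/280_of_rank_three`: if moreover `2·ord(g) < |A|` for all `g` (true for every abelian
  group of these orders with `dim A/2A ≥ 3`), no TPP triple attains the law — e.g. `ℤ₄³, ℤ₂²×ℤ₄², ℤ₂⁴×ℤ₄,
  ℤ₂×ℤ₄×ℤ₈, ℤ₂³×ℤ₈, ℤ₂²×ℤ₁₆, ℤ₂⁶` (order 64), `ℤ₂³×ℤ₁₇` (136), `ℤ₂³×ℤ₃₅` (280), the 19 abelian groups of order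
  `256` of `2`-rank `≥ 3`.
-/

namespace Summit.MatrixMultiplication.OmegaCensus

open Literature.Combinatorics.Additive Finset

/-! ## Arithmetic: factorisations of `(|A| − 1)/3` with a small part -/

section Arith

/-- The factorisation property (two parts `1`, or a part in `[2, 6]`) when `q < 49`. [folklore] -/
theorem cube_factor_small_of_lt_49 {q c d e : ℕ} (hq : c * d * e = q) (hq0 : 0 < q) (hlt : q < 49) :
    (c = 1 ∧ d = 1) ∨ (d = 1 ∧ e = 1) ∨ (c = 1 ∧ e = 1) ∨ (2 ≤ c ∧ c ≤ 6) ∨ (2 ≤ d ∧ d ≤ 6) ∨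
      (2 ≤ e ∧ e ≤ 6) := by
  rcases Nat.eq_zero_or_pos c with rfl | hc
  · simp at hq; omega
  rcases Nat.eq_zero_or_pos d with rfl | hd
  · simp at hq; omega
  rcases Nat.eq_zero_or_pos e with rfl | he
  · simp at hq; omega
  have hde : d * e ≤ c * d * e := by rw [mul_assoc]; exact Nat.le_mul_of_pos_left _ hc
  have hce : c * e ≤ c * d * e := by
    rw [mul_right_comm]; exact Nat.le_mul_of_pos_right _ hd
  have hcd : c * d ≤ c * d * e := Nat.le_mul_of_pos_right _ he
  rcases le_or_gt 7 c with hc7 | hc7 <;> rcases le_or_gt 7 d with hd7 | hd7 <;> rcases le_or_gt 7 e with he7 | he7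
  · have := Nat.mul_le_mul hc7 hd7; omega
  · have := Nat.mul_le_mul hc7 hd7; omega
  · have := Nat.mul_le_mul hc7 he7; omega
  · omega
  · have := Nat.mul_le_mul hd7 he7; omega
  · omega
  · omega
  · omega

/-- `|A| = 64`: `cde = 21`. [folklore] -/
theorem cube_factor_small_64 {c d e : ℕ} (h : 3 * (c * d * e) + 1 = 64) :
    (c = 1 ∧ d = 1) ∨ (d = 1 ∧ e = 1) ∨ (c = 1 ∧ e = 1) ∨ (2 ≤ c ∧ c ≤ 6) ∨ (2 ≤ d ∧ d ≤ 6) ∨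
      (2 ≤ e ∧ e ≤ 6) :=
  cube_factor_small_of_lt_49 (q := 21) (by omega) (by norm_num) (by norm_num)

/-- `|A| = 136`: `cde = 45`. [folklore] -/
theorem cube_factor_small_136 {c d e : ℕ} (h : 3 * (c * d * e) + 1 = 136) :
    (c = 1 ∧ d = 1) ∨ (d = 1 ∧ e = 1) ∨ (c = 1 ∧ e = 1) ∨ (2 ≤ c ∧ c ≤ 6) ∨ (2 ≤ d ∧ d ≤ 6) ∨
      (2 ≤ e ∧ e ≤ 6) :=
  cube_factor_small_of_lt_49 (q := 45) (by omega) (by norm_num) (by norm_num)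

/-- The factorisation property when `q < 343` has no divisor `m` with `7 ≤ m`, `m² ≤ q` (e.g. `q = 85, 93`).
[folklore] -/
theorem cube_factor_small_of_no_mid_divisor {q c d e : ℕ} (hq : c * d * e = q) (hq0 : 0 < q) (hlt : q < 343)
    (hdiv : ∀ m, 7 ≤ m → m * m ≤ q → ¬ m ∣ q) :
    (c = 1 ∧ d = 1) ∨ (d = 1 ∧ e = 1) ∨ (c = 1 ∧ e = 1) ∨ (2 ≤ c ∧ c ≤ 6) ∨ (2 ≤ d ∧ d ≤ 6) ∨
      (2 ≤ e ∧ e ≤ 6) := by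
  rcases Nat.eq_zero_or_pos c with rfl | hc
  · simp at hq; omega
  rcases Nat.eq_zero_or_pos d with rfl | hd
  · simp at hq; omega
  rcases Nat.eq_zero_or_pos e with rfl | he
  · simp at hq; omega
  -- two factors `≥ 7` with product `q`: the smaller one is a divisor `m` with `m² ≤ q`
  have key : ∀ x y : ℕ, 7 ≤ x → 7 ≤ y → x * y = q → False := by
    intro x y hx hy hxy
    rcases le_total x y with hle | hle
    · exact hdiv x hx (by rw [← hxy]; exact Nat.mul_le_mul_left x hle) ⟨y, hxy.symm⟩
    · exact hdiv y hy (by rw [← hxy]; exact Nat.mul_le_mul_right y hle) ⟨x, by rw [← hxy]; ring⟩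
  rcases le_or_gt 7 c with hc7 | hc7 <;> rcases le_or_gt 7 d with hd7 | hd7 <;> rcases le_or_gt 7 e with he7 | he7
  · have h1 := Nat.mul_le_mul (Nat.mul_le_mul hc7 hd7) he7; omega
  · by_cases he1 : e = 1
    · subst he1; exact (key c d hc7 hd7 (by simpa using hq)).elim
    · omega
  · by_cases hd1 : d = 1
    · subst hd1; exact (key c e hc7 he7 (by simpa using hq)).elim
    · omega
  · omega
  · by_cases hc1 : c = 1
    · subst hc1; exact (key d e hd7 he7 (by simpa using hq)).elim
    · omega
  · omega
  · omega
  · omega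

/-- `|A| = 256`: `cde = 85`. [folklore] -/
theorem cube_factor_small_256 {c d e : ℕ} (h : 3 * (c * d * e) + 1 = 256) :
    (c = 1 ∧ d = 1) ∨ (d = 1 ∧ e = 1) ∨ (c = 1 ∧ e = 1) ∨ (2 ≤ c ∧ c ≤ 6) ∨ (2 ≤ d ∧ d ≤ 6) ∨
      (2 ≤ e ∧ e ≤ 6) :=
  cube_factor_small_of_no_mid_divisor (q := 85) (by omega) (by norm_num) (by norm_num)
    (by intro m hm hm'; have : m ≤ 9 := by nlinarith
        interval_cases m <;> norm_num)

/-- `|A| = 280`: `cde = 93`. [folklore] -/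
theorem cube_factor_small_280 {c d e : ℕ} (h : 3 * (c * d * e) + 1 = 280) :
    (c = 1 ∧ d = 1) ∨ (d = 1 ∧ e = 1) ∨ (c = 1 ∧ e = 1) ∨ (2 ≤ c ∧ c ≤ 6) ∨ (2 ≤ d ∧ d ≤ 6) ∨
      (2 ≤ e ∧ e ≤ 6) :=
  cube_factor_small_of_no_mid_divisor (q := 93) (by omega) (by norm_num) (by norm_num)
    (by intro m hm hm'; have : m ≤ 9 := by nlinarith
        interval_cases m <;> norm_num)

end Arith

/-! ## Assembly -/

section DihedralLike

variable {A : Type*} [AddCommGroup A] [DecidableEq A] [Fintype A] {G : Type} [Group G] [DecidableEq G]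
  {ρ τ : A → G} {c₀ : A} {S T U : Finset G}

/-- **Rank three: every law triple forces an element of order `≥ |A|/2`,** provided every factorisation
`cde = (|A| − 1)/3` has two parts `1` or a part in `[2, 6]`. [folklore] -/
theorem card_le_two_mul_addOrderOf_of_law_rank_three
    (hρρ : ∀ a b, ρ a * ρ b = ρ (a + b)) (hρτ : ∀ a b, ρ a * τ b = τ (b - a))
    (hτρ : ∀ a b, τ a * ρ b = τ (a + b)) (hττ : ∀ a b, τ a * τ b = ρ (c₀ + b - a))
    (hρ : Function.Injective ρ) (hτ : Function.Injective τ) (hne : ∀ a b, ρ a ≠ τ b)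
    (hsurj : ∀ g, (∃ a, ρ a = g) ∨ (∃ a, τ a = g)) (hA : 14 ≤ Fintype.card A)
    (ψ₁ ψ₂ ψ₃ : A →+ ZMod 2) (hψ : ∀ v : ZMod 2 × ZMod 2 × ZMod 2, ∃ a, (ψ₁ a, ψ₂ a, ψ₃ a) = v)
    (hq : ∀ c d e : ℕ, 3 * (c * d * e) + 1 = Fintype.card A →
      (c = 1 ∧ d = 1) ∨ (d = 1 ∧ e = 1) ∨ (c = 1 ∧ e = 1) ∨ (2 ≤ c ∧ c ≤ 6) ∨ (2 ≤ d ∧ d ≤ 6) ∨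
        (2 ≤ e ∧ e ≤ 6))
    (h : TripleProductProperty S T U) (hV : 3 * (S.card * T.card * U.card) + 8 = 8 * Fintype.card A) :
    ∃ g : A, Fintype.card A ≤ 2 * addOrderOf g := by
  have hmod : Fintype.card A % 3 = 1 := by omega
  have hA7 : 7 ≤ Fintype.card A := by omega
  have hV_TUS : 3 * (T.card * U.card * S.card) + 8 = 8 * Fintype.card A := by
    rw [show T.card * U.card * S.card = S.card * T.card * U.card by ring]; exact hV
  have hV_UST : 3 * (U.card * S.card * T.card) + 8 = 8 * Fintype.card A := by
    rw [show U.card * S.card * T.card = S.card * T.card * U.card by ring]; exact hV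
  have hTUS : TripleProductProperty T U S := h.rotate
  have hUST : TripleProductProperty U S T := h.rotate.rotate
  by_cases hnc : ((univ.filter fun a : A => ρ a ∈ S).card = (univ.filter fun a : A => τ a ∈ S).card ∧
      (univ.filter fun a : A => ρ a ∈ T).card = (univ.filter fun a : A => τ a ∈ T).card ∧
      (univ.filter fun a : A => ρ a ∈ U).card = (univ.filter fun a : A => τ a ∈ U).card)
  · obtain ⟨hS', hT', hU'⟩ := hnc
    have cS := card_eq_parts' hρ hτ hne hsurj S
    have cT := card_eq_parts' hρ hτ hne hsurj T
    have cU := card_eq_parts' hρ hτ hne hsurj U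
    set s₀ := (univ.filter fun a : A => ρ a ∈ S).card with hs₀
    set t₀ := (univ.filter fun a : A => ρ a ∈ T).card with ht₀
    set u₀ := (univ.filter fun a : A => ρ a ∈ U).card with hu₀
    have eS : S.card = 2 * s₀ := by rw [cS, ← hS']; ring
    have eT : T.card = 2 * t₀ := by rw [cT, ← hT']; ring
    have eU : U.card = 2 * u₀ := by rw [cU, ← hU']; ring
    have hprod : 3 * (s₀ * t₀ * u₀) + 1 = Fintype.card A := by
      rw [eS, eT, eU] at hV; nlinarith
    rcases hq s₀ t₀ u₀ hprod with ⟨h1, h1'⟩ | ⟨h1, h1'⟩ | ⟨h1, h1'⟩ | hc | hd | he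
    · exact card_le_two_mul_addOrderOf_of_two_two_law hρρ hρτ hτρ hττ hρ hτ hne hsurj hmod hA7 h
        (by rw [eS, h1]) (by rw [eT, h1']) hV
    · exact card_le_two_mul_addOrderOf_of_two_two_law hρρ hρτ hτρ hττ hρ hτ hne hsurj hmod hA7 hTUS
        (by rw [eT, h1]) (by rw [eU, h1']) hV_TUS
    · exact card_le_two_mul_addOrderOf_of_two_two_law hρρ hρτ hτρ hττ hρ hτ hne hsurj hmod hA7 hUST
        (by rw [eU, h1']) (by rw [eS, h1]) hV_UST
    · exact (no_law_cube_part_small_left hρρ hρτ hτρ hττ hρ hτ hne hsurj ψ₁ ψ₂ ψ₃ hψ h hS' hT' hU' hc hV).elim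
    · exact (no_law_cube_part_small hρρ hρτ hτρ hττ hρ hτ hne hsurj ψ₁ ψ₂ ψ₃ hψ h hS' hT' hU' hd hV).elim
    · exact (no_law_cube_part_small_right hρρ hρτ hτρ hττ hρ hτ hne hsurj ψ₁ ψ₂ ψ₃ hψ h hS' hT' hU' he hV).elim
  · obtain ⟨g, a, b, hab⟩ :=
      two_cosets_of_mod_one_law_of_not_cube hρρ hρτ hτρ hττ hρ hτ hne hsurj hmod hA h hV hnc
    exact ⟨g, card_le_two_mul_addOrderOf_of_two_cosets hab⟩

/-- **No law over rank-three `A` with small element orders**, under the factorisation property. [folklore] -/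
theorem no_law_of_rank_three_small_orders
    (hρρ : ∀ a b, ρ a * ρ b = ρ (a + b)) (hρτ : ∀ a b, ρ a * τ b = τ (b - a))
    (hτρ : ∀ a b, τ a * ρ b = τ (a + b)) (hττ : ∀ a b, τ a * τ b = ρ (c₀ + b - a))
    (hρ : Function.Injective ρ) (hτ : Function.Injective τ) (hne : ∀ a b, ρ a ≠ τ b)
    (hsurj : ∀ g, (∃ a, ρ a = g) ∨ (∃ a, τ a = g)) (hA : 14 ≤ Fintype.card A)
    (ψ₁ ψ₂ ψ₃ : A →+ ZMod 2) (hψ : ∀ v : ZMod 2 × ZMod 2 × ZMod 2, ∃ a, (ψ₁ a, ψ₂ a, ψ₃ a) = v)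
    (hq : ∀ c d e : ℕ, 3 * (c * d * e) + 1 = Fintype.card A →
      (c = 1 ∧ d = 1) ∨ (d = 1 ∧ e = 1) ∨ (c = 1 ∧ e = 1) ∨ (2 ≤ c ∧ c ≤ 6) ∨ (2 ≤ d ∧ d ≤ 6) ∨
        (2 ≤ e ∧ e ≤ 6))
    (hord : ∀ g : A, 2 * addOrderOf g < Fintype.card A) (h : TripleProductProperty S T U) :
    3 * (S.card * T.card * U.card) + 8 ≠ 8 * Fintype.card A := by
  intro hV
  obtain ⟨g, hg⟩ := card_le_two_mul_addOrderOf_of_law_rank_three hρρ hρτ hτρ hττ hρ hτ hne hsurj hA ψ₁ ψ₂ ψ₃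
    hψ hq h hV
  exact absurd (hord g) (not_lt.2 hg)

/-- **`|A| = 64`, `dim A/2A ≥ 3`, all element orders `< 32` (`ℤ₄³, ℤ₂²×ℤ₄², ℤ₂⁴×ℤ₄, ℤ₂×ℤ₄×ℤ₈, ℤ₂³×ℤ₈, ℤ₂²×ℤ₁₆,
ℤ₂⁶`): no dihedral-like group over `A` attains `3|S||T||U| + 8 = 8|A|`.** [folklore] -/
theorem no_law_card_64_of_rank_three
    (hρρ : ∀ a b, ρ a * ρ b = ρ (a + b)) (hρτ : ∀ a b, ρ a * τ b = τ (b - a))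
    (hτρ : ∀ a b, τ a * ρ b = τ (a + b)) (hττ : ∀ a b, τ a * τ b = ρ (c₀ + b - a))
    (hρ : Function.Injective ρ) (hτ : Function.Injective τ) (hne : ∀ a b, ρ a ≠ τ b)
    (hsurj : ∀ g, (∃ a, ρ a = g) ∨ (∃ a, τ a = g)) (hA : Fintype.card A = 64)
    (ψ₁ ψ₂ ψ₃ : A →+ ZMod 2) (hψ : ∀ v : ZMod 2 × ZMod 2 × ZMod 2, ∃ a, (ψ₁ a, ψ₂ a, ψ₃ a) = v)
    (hord : ∀ g : A, 2 * addOrderOf g < Fintype.card A) (h : TripleProductProperty S T U) :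
    3 * (S.card * T.card * U.card) + 8 ≠ 8 * Fintype.card A :=
  no_law_of_rank_three_small_orders hρρ hρτ hτρ hττ hρ hτ hne hsurj (by rw [hA]; norm_num) ψ₁ ψ₂ ψ₃ hψ
    (fun c d e hcde => cube_factor_small_64 (by rw [hcde, hA])) hord h

/-- **`|A| = 136`, `dim A/2A ≥ 3`, all element orders `< 68` (`ℤ₂³ × ℤ₁₇`): no law.** [folklore] -/
theorem no_law_card_136_of_rank_three
    (hρρ : ∀ a b, ρ a * ρ b = ρ (a + b)) (hρτ : ∀ a b, ρ a * τ b = τ (b - a))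
    (hτρ : ∀ a b, τ a * ρ b = τ (a + b)) (hττ : ∀ a b, τ a * τ b = ρ (c₀ + b - a))
    (hρ : Function.Injective ρ) (hτ : Function.Injective τ) (hne : ∀ a b, ρ a ≠ τ b)
    (hsurj : ∀ g, (∃ a, ρ a = g) ∨ (∃ a, τ a = g)) (hA : Fintype.card A = 136)
    (ψ₁ ψ₂ ψ₃ : A →+ ZMod 2) (hψ : ∀ v : ZMod 2 × ZMod 2 × ZMod 2, ∃ a, (ψ₁ a, ψ₂ a, ψ₃ a) = v)
    (hord : ∀ g : A, 2 * addOrderOf g < Fintype.card A) (h : TripleProductProperty S T U) :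
    3 * (S.card * T.card * U.card) + 8 ≠ 8 * Fintype.card A :=
  no_law_of_rank_three_small_orders hρρ hρτ hτρ hττ hρ hτ hne hsurj (by rw [hA]; norm_num) ψ₁ ψ₂ ψ₃ hψ
    (fun c d e hcde => cube_factor_small_136 (by rw [hcde, hA])) hord h

/-- **`|A| = 256`, `dim A/2A ≥ 3` (then all element orders are `≤ 64 < 128`): no law.** [folklore] -/
theorem no_law_card_256_of_rank_three
    (hρρ : ∀ a b, ρ a * ρ b = ρ (a + b)) (hρτ : ∀ a b, ρ a * τ b = τ (b - a))
    (hτρ : ∀ a b, τ a * ρ b = τ (a + b)) (hττ : ∀ a b, τ a * τ b = ρ (c₀ + b - a))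
    (hρ : Function.Injective ρ) (hτ : Function.Injective τ) (hne : ∀ a b, ρ a ≠ τ b)
    (hsurj : ∀ g, (∃ a, ρ a = g) ∨ (∃ a, τ a = g)) (hA : Fintype.card A = 256)
    (ψ₁ ψ₂ ψ₃ : A →+ ZMod 2) (hψ : ∀ v : ZMod 2 × ZMod 2 × ZMod 2, ∃ a, (ψ₁ a, ψ₂ a, ψ₃ a) = v)
    (hord : ∀ g : A, 2 * addOrderOf g < Fintype.card A) (h : TripleProductProperty S T U) :
    3 * (S.card * T.card * U.card) + 8 ≠ 8 * Fintype.card A :=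
  no_law_of_rank_three_small_orders hρρ hρτ hτρ hττ hρ hτ hne hsurj (by rw [hA]; norm_num) ψ₁ ψ₂ ψ₃ hψ
    (fun c d e hcde => cube_factor_small_256 (by rw [hcde, hA])) hord h

/-- **`|A| = 280`, `dim A/2A ≥ 3`, all element orders `< 140` (`ℤ₂³ × ℤ₃₅`): no law.** [folklore] -/
theorem no_law_card_280_of_rank_three
    (hρρ : ∀ a b, ρ a * ρ b = ρ (a + b)) (hρτ : ∀ a b, ρ a * τ b = τ (b - a))
    (hτρ : ∀ a b, τ a * ρ b = τ (a + b)) (hττ : ∀ a b, τ a * τ b = ρ (c₀ + b - a))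
    (hρ : Function.Injective ρ) (hτ : Function.Injective τ) (hne : ∀ a b, ρ a ≠ τ b)
    (hsurj : ∀ g, (∃ a, ρ a = g) ∨ (∃ a, τ a = g)) (hA : Fintype.card A = 280)
    (ψ₁ ψ₂ ψ₃ : A →+ ZMod 2) (hψ : ∀ v : ZMod 2 × ZMod 2 × ZMod 2, ∃ a, (ψ₁ a, ψ₂ a, ψ₃ a) = v)
    (hord : ∀ g : A, 2 * addOrderOf g < Fintype.card A) (h : TripleProductProperty S T U) :
    3 * (S.card * T.card * U.card) + 8 ≠ 8 * Fintype.card A :=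
  no_law_of_rank_three_small_orders hρρ hρτ hτρ hττ hρ hτ hne hsurj (by rw [hA]; norm_num) ψ₁ ψ₂ ψ₃ hψ
    (fun c d e hcde => cube_factor_small_280 (by rw [hcde, hA])) hord h

end DihedralLike

end Summit.MatrixMultiplication.OmegaCensus
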